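import Literature.Topology.FourManifolds.ZeroSurgeryHomotopyBallSliceReduction
import Literature.Topology.FourManifolds.SliceDiscEndCollarFactsProofs
import Literature.Topology.FourManifolds.DehnSurgeryCompactProofs
import Literature.Topology.FourManifolds.GluckTwistSimplyConnected
import Literature.Topology.FourManifolds.OpenTraceSimplyConnected
import Literature.Topology.FourManifolds.SmallSetComplement
import Literature.AlgebraicTopology.FundamentalGroup.VanKampenKernel
import Mathlib.Analysis.InnerProductSpace.Calculus
import HarnessLib

/-!
# Manolescu–Piccirillo Lemma 3.3 for `W = S⁴`: the glued manifold is simply connected (proved)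

Topic `Literature/Topology/FourManifolds`; fact seat
`provefact-Literature.Topology.FourManifolds.Knot.s-5d4aaec47c` for the named fact
`Literature.Topology.FourManifolds.Knot.simplyConnectedSpace_of_isSliceDiscIn_of_range_eq` (`PI1`,
`ZeroSurgeryHomotopyBallSliceProofs.lean`), the fundamental-group leaf of the decomposition
`CONSTR → PI1 → H2 → S10` of Manolescu–Piccirillo's Lemma 3.3 for `W = S⁴`
(`Knot.ManolescuPiccirillo2023_lemma33_sphere`).

## What the source says, and what this file proves

C. Manolescu, L. Piccirillo, *From zero surgeries to candidates for exotic definite 4-manifolds*,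
J. Lond. Math. Soc. (2) 108 (2023), §3.2, proof of Lemma 3.3 (arXiv v3 p. 7, there numbered
Lemma 3.5), verbatim: "consider the 4-manifold `V` obtained by excising an open tubular
neighborhood of that disk from `W°`. It is routine to confirm that `∂V ≅ S³₀(K)` and that `π₁(V)` is
normally generated by `ι_*(π₁(∂V))` … Now consider the 4-manifold `X := X(−K') ∪_φ V` … we see that
`X` has a handle diagram obtained from that of `V` by adding an additional 0-framed 2-handle along
`φ(μ_{K'})`, followed by a 4-handle. As such, `π₁(X) = π₁(V)/⟨[φ(μ_{K'})]⟩`. Since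
`π₁(S³₀(K'))/⟨[μ_{K'}]⟩ = 1` we have `π₁(∂V)/⟨[φ(μ_{K'})]⟩ = 1`. Since `π₁(V)` is normally generated
by `π₁(∂V)`, we have that `π₁(X) = 1`."

The source thus proves `π₁ = 1` for THE glued manifold `X(−K') ∪_φ V`, from its handle structure.
This file **proves exactly that statement** for the tree's model of the gluing — the pushout
`SmoothGlueData.ofCollars cT cV …` (`ZeroSurgeryHomotopyBallSliceConstruction.lean`) of the open
trace of `K'` and the open slice-disc exterior `B̊⁴ ∖ Δ` of `K` along collars `Y × ℝ` of the common
`0`-surgery `Y` — and re-threads the DAG of `Knot.ManolescuPiccirillo2023_lemma33_sphere` through it: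

* `SmoothGlueData.simplyConnectedSpace_glued` / `…_of_simplyConnected` — van Kampen's easy half for
  the tree's gluing construction (loops of the two pieces dying in the glued space, path connected
  gluing region); the trace side is simply connected by `TubeNbhd.simplyConnectedSpace_openTrace`
  (`OpenTraceSimplyConnected.lean`).
* `isPathConnected_sliceDiscExterior` — `B̊⁴ ∖ Δ` is path connected (codimension-`2` general
  position, `isPathConnected_compl_of_subset_iUnion_image`, after straightening the ball onto `ℝ⁴`).
* `map_inr_homotopic_refl_of_mem_target`, `simplyConnectedSpace_glued_sliceDiscExterior` — **if
  `B̊⁴ ∖ Δ` is glued to a simply connected manifold along a path connected open region with compact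
  complement (a collar of its end), the result is simply connected.** This is the quoted argument:
  "`π₁(V)` normally generated by `π₁(∂V)`" and "those generators die in `X(−K')`" are obtained in one
  stroke from the Seifert–van Kampen theorem in kernel form
  (`Literature.AlgebraicTopology.FundamentalGroup.VanKampen.fromPath_mem_of_homotopic_refl`, Hatcher
  Thm. 1.20) applied to the cover of the simply connected `ℝ⁴` by `E = B̊⁴ ∖ Δ` and the complement of
  the compact core `E ∖ (collar)`, with `N = ker (inr_* : π₁(E) → π₁(X))`: loops of `E` inside the
  collar map into the image of the simply connected trace side, so they lie in `N`; hence so does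
  every loop of `E`.
* `simplyConnectedSpace_ofCollars_sliceDiscExterior` — the instance for `ofCollars cT cV`.
* `Knot.exists_simplyConnected_openTrace_of_isIntegralSurgery` — the proved leaf (T) of the
  construction with `SimplyConnectedSpace T` recorded.
* `Knot.ManolescuPiccirillo2023_lemma33_sphere_core_of_endCollar` (`(V) → H2 → CORE`),
  `Knot.ManolescuPiccirillo2023_lemma33_sphere_of_endCollar` (`(V) → H2 → S10 → Lemma 3.3`),
  `Knot.ManolescuPiccirillo2023_lemma33_sphere_of_conicalTube`
  (`exists_conicalTube_hasFraming_zero → H2 → S10 → Lemma 3.3`, using the proved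
  `exists_conical_diffeomorph_holds` and `exists_openTrace_of_isIntegralSurgery_holds`) and the
  exotic-sphere corollary. **After this file `Knot.ManolescuPiccirillo2023_lemma33_sphere` rests on
  three named facts — `Knot.IsSliceDisc.exists_conicalTube_hasFraming_zero`,
  `Knot.isZero_singularHomologyZ_two_of_isSliceDiscIn_of_range_eq` (`H2`),
  `FourManifolds.nonempty_homotopyEquiv_sphere_four_iff` (`S10`) — and no longer on `PI1`.**

## What is NOT here: the fact `PI1` itself

`Knot.simplyConnectedSpace_of_isSliceDiscIn_of_range_eq` is **not** discharged. It asserts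
`π₁(X) = 1` for EVERY closed smooth `X` containing a ball `e(𝔻⁴)`, a proper disc `f(𝔻²)` for `K'`
(`IsSliceDiscIn`, which deliberately does not require the disc to be transverse to `e(S³)`) and a
diffeomorphism `j` of `B̊⁴ ∖ Δ` onto `X ∖ (e(𝔻⁴) ∪ f(𝔻²))`. That is a generalisation the source
neither states nor proves: its docstring's justification ("the regular neighbourhood of
`e(𝔻⁴) ∪ f(𝔻²)` is `B⁴ ∪_{K'} h²` for some framing") presupposes a smooth regular neighbourhood,
i.e. a disc neat with respect to the ball, and in general needs a tubular/regular-neighbourhood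
theory for `2`-complexes in abstract `4`-manifolds (for non-transverse `f` even the topology of
`f(𝔻²) ∩ e(B_R ∖ 𝔻⁴)` is uncontrolled) which neither the source nor the tree provides. The session
notes record this as a mis-statement relative to the source (statement stronger than the printed
one); the printed statement is the theorem `simplyConnectedSpace_ofCollars_sliceDiscExterior` above,
and every consumer of `PI1` in the tree (`…_core_of_facts`, `…_of_facts`, `…_of_collars`,
`…_of_sliceDisc_facts`) now has a `PI1`-free twin here.

## References

* C. Manolescu, L. Piccirillo, J. Lond. Math. Soc. (2) 108 (2023) 2001–2036, §3.2, Lemma 3.3 and its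
  proof, Def. 3.4 (arXiv:2102.04391 v3, p. 7, Lemma 3.5 / Def. 3.6) [ManolescuPiccirillo2023].
* A. Hatcher, *Algebraic Topology* (2002), §1.2, Lemma 1.15 and Thm. 1.20 (van Kampen)
  [HatcherAT2002].
* W. Hurewicz, H. Wallman, *Dimension Theory* (1941), Ch. IV §5, Thm. IV 4 [HurewiczWallman1941].

## Design notes

* The gluing lemmas are stated for an arbitrary `SmoothGlueData` (any models); the exterior lemmas
  for an arbitrary simply connected partner `A` glued to `sliceDiscExterior g` along a region with
  compact complement, which is exactly what the collar fact (V) supplies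
  (`IsCompact (cV.targetᶜ ∪ …)`).
* The kernel form of van Kampen is applied in the ambient `ℝ⁴` (not in `B̊⁴`): `U = B̊⁴ ∖ Δ`,
  `T = ℝ⁴ ∖ (core)`, `U ∪ T = ℝ⁴`; only `U` and `U ∩ T = collar` need to be path connected.
* `FundamentalGroup.map_fromPath_eq_one_iff` is the one-line bridge between Mathlib's induced map
  `FundamentalGroup.map` and null-homotopy of the image loop; the normal subgroup fed to van Kampen
  is a `MonoidHom.ker`, so no normal-closure bookkeeping is needed.
* No definitions, no named facts, no `sorry`; the new theorems depend only on `propext`,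
  `Classical.choice`, `Quot.sound`.
-/

open scoped Manifold ContDiff Topology
open Set Function Metric
open Literature.AlgebraicTopology.FundamentalGroup

noncomputable section

namespace Literature.Topology.FourManifolds


/-- Local notation: `𝔼 n` is the model Euclidean space `EuclideanSpace ℝ (Fin n)`. -/
local notation "𝔼 " n:arg => EuclideanSpace ℝ (Fin n)

/-! ### Loops inside the range of an embedding -/

section Embedding

variable {A X : Type*} [TopologicalSpace A] [TopologicalSpace X]

/-- A loop of `X` lying in the range of a topological embedding `f : A → X` is the image of a
loop of `A` (pull back along the homeomorphism `A ≃ₜ range f`). [folklore] -/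
theorem exists_path_eq_comp_of_forall_mem_range {f : A → X} (hf : _root_.Topology.IsEmbedding f)
    {x : X} (δ : Path x x) (h : ∀ t, δ t ∈ range f) :
    ∃ (a : A) (α : Path a a), ∀ t, δ t = f (α t) := by
  have hx : x ∈ range f := δ.source ▸ h 0
  let e := hf.toHomeomorph
  let δ' : Path (⟨x, hx⟩ : range f) ⟨x, hx⟩ :=
    { toFun := fun t ↦ ⟨δ t, h t⟩
      continuous_toFun := δ.continuous.subtype_mk _
      source' := Subtype.ext δ.source
      target' := Subtype.ext δ.target }
  refine ⟨e.symm ⟨x, hx⟩, δ'.map e.symm.continuous, fun t ↦ ?_⟩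
  have h1 : e (e.symm ⟨δ t, h t⟩) = ⟨δ t, h t⟩ := e.apply_symm_apply _
  have h2 := congrArg Subtype.val h1
  rw [_root_.Topology.IsEmbedding.toHomeomorph_apply_coe] at h2
  exact h2.symm

/-- If a loop `δ` of `X` is pointwise `f ∘ α` for a loop `α` of `A` whose image `f ∘ α` is
null-homotopic, then `δ` is null-homotopic (the two loops agree after identifying the base points).
[folklore] -/
theorem Path.Homotopic.refl_of_eq_comp {f : A → X} (hf : Continuous f) {a : A} {α : Path a a}
    (hα : (α.map hf).Homotopic ((Path.refl a).map hf)) {x : X} (δ : Path x x)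
    (h : ∀ t, δ t = f (α t)) : δ.Homotopic (Path.refl x) := by
  have hx : x = f a := by simpa using h 0
  subst hx
  have hδ : δ = α.map hf := by
    ext t
    exact h t
  subst hδ
  have e : (Path.refl a).map hf = Path.refl (f a) := by
    ext t
    rfl
  exact e ▸ hα

/-- Loops in the range of an embedding of a simply connected space are null-homotopic. [folklore] -/
theorem Path.Homotopic.refl_of_forall_mem_range_of_simplyConnected [SimplyConnectedSpace A]
    {f : A → X} (hf : _root_.Topology.IsEmbedding f) {x : X} (δ : Path x x)
    (h : ∀ t, δ t ∈ range f) : δ.Homotopic (Path.refl x) := by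
  obtain ⟨a, α, hα⟩ := exists_path_eq_comp_of_forall_mem_range hf δ h
  exact Path.Homotopic.refl_of_eq_comp hf.continuous
    ((SimplyConnectedSpace.paths_homotopic α (Path.refl a)).map ⟨f, hf.continuous⟩) δ hα

end Embedding

/-! ### Simple connectivity of glued manifolds -/

namespace SmoothGlueData

variable {E_A H_A E_B H_B : Type*}
  [NormedAddCommGroup E_A] [NormedSpace ℝ E_A] [TopologicalSpace H_A]
  [NormedAddCommGroup E_B] [NormedSpace ℝ E_B] [TopologicalSpace H_B]
  {I_A : ModelWithCorners ℝ E_A H_A} {I_B : ModelWithCorners ℝ E_B H_B}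
  {A : Type*} [TopologicalSpace A] [ChartedSpace H_A A]
  {B : Type*} [TopologicalSpace B] [ChartedSpace H_B B]
  {E_P : Type*} [NormedAddCommGroup E_P] [NormedSpace ℝ E_P]
  (d : SmoothGlueData I_A I_B A B E_P)

/-- The two charts of a glued space overlap exactly in the image of the gluing region:
`range inl ∩ range inr = inr(glue.target)`. [folklore] -/
theorem range_inl_inter_range_inr : range d.inl ∩ range d.inr = d.inr '' d.glue.target := by
  ext p
  constructor
  · rintro ⟨hp, ⟨b, rfl⟩⟩
    exact ⟨b, d.inr_mem_range_inl_iff.1 hp, rfl⟩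
  · rintro ⟨b, hb, rfl⟩
    exact ⟨d.inr_mem_range_inl_iff.2 hb, b, rfl⟩

/-- **Van Kampen's easy half for a glued space** (Hatcher, *Algebraic Topology* (2002),
Lemma 1.15, applied to the open cover `A ∪_glue B = inl(A) ∪ inr(B)`): if `A` and `B` are path
connected, the gluing region is path connected, and every loop of `A` and every loop of `B` becomes
null-homotopic in the glued space, then the glued space is simply connected.
[cite: HatcherAT2002, Lemma 1.15] -/
theorem simplyConnectedSpace_glued [PathConnectedSpace A] [PathConnectedSpace B]
    (htgt : IsPathConnected d.glue.target)
    (hA : ∀ (a : A) (α : Path a a),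
      (α.map d.continuous_inl).Homotopic ((Path.refl a).map d.continuous_inl))
    (hB : ∀ (b : B) (β : Path b b),
      (β.map d.continuous_inr).Homotopic ((Path.refl b).map d.continuous_inr)) :
    SimplyConnectedSpace d.Glued := by
  obtain ⟨b₀, hb₀⟩ := htgt.nonempty
  have hxV : d.inr b₀ ∈ range d.inr := ⟨b₀, rfl⟩
  have hxU : d.inr b₀ ∈ range d.inl := d.inr_mem_range_inl_iff.2 hb₀
  refine simplyConnectedSpace_of_isOpen_cover_of_loops d.isOpen_range_inl d.isOpen_range_inr
    d.range_inl_union_range_inr hxU hxV (isPathConnected_range d.continuous_inl)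
    (isPathConnected_range d.continuous_inr) (fun δ hδ ↦ ?_) (fun δ hδ ↦ ?_) ?_
  · obtain ⟨a, α, hα⟩ := exists_path_eq_comp_of_forall_mem_range
      d.isOpenEmbedding_inl.isEmbedding δ hδ
    exact Path.Homotopic.refl_of_eq_comp d.continuous_inl (hA a α) δ hα
  · obtain ⟨b, β, hβ⟩ := exists_path_eq_comp_of_forall_mem_range
      d.isOpenEmbedding_inr.isEmbedding δ hδ
    exact Path.Homotopic.refl_of_eq_comp d.continuous_inr (hB b β) δ hβ
  · rw [d.range_inl_inter_range_inr]
    exact htgt.image d.continuous_inr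

/-- In particular a gluing of two simply connected manifolds along a path-connected region is simply
connected (e.g. the open trace `ℝ⁴ ∪ (ℝ² × ℝ²)` of a framed knot).
[cite: HatcherAT2002, Lemma 1.15] -/
theorem simplyConnectedSpace_glued_of_simplyConnected [SimplyConnectedSpace A]
    [SimplyConnectedSpace B] (htgt : IsPathConnected d.glue.target) :
    SimplyConnectedSpace d.Glued :=
  d.simplyConnectedSpace_glued htgt
    (fun a α ↦ (SimplyConnectedSpace.paths_homotopic α (Path.refl a)).map ⟨d.inl, d.continuous_inl⟩)
    (fun b β ↦ (SimplyConnectedSpace.paths_homotopic β (Path.refl b)).map ⟨d.inr, d.continuous_inr⟩)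

end SmoothGlueData




/-! ### The open slice-disc exterior is path connected -/

/-- **The open slice-disc exterior `B̊⁴ ∖ Δ` is path connected.** For a slice disc `g` of a knot
`K` the set removed from the open ball is `g(D̊²)` (the boundary circle goes to `𝕊³`), a closed
`C¹` image of the `2`-dimensional open disc; after straightening the open ball onto `ℝ⁴`
(Mathlib's `univUnitBall`) this is the general-position statement that a closed set of codimension
`≥ 2` does not separate a connected manifold
(`Literature.Topology.FourManifolds.isPathConnected_compl_of_subset_iUnion_image`; Hurewicz–Wallman,
*Dimension Theory* (1941), Thm. IV 4).
[cite: HurewiczWallman1941, Ch. IV §5, Thm. IV 4 and Cor. 1] -/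
theorem isPathConnected_sliceDiscExterior {K : Knot} {g : 𝔼 2 → 𝔼 4} (hg : K.IsSliceDisc g) :
    IsPathConnected (sliceDiscExterior g : Set (𝔼 4)) := by
  set φ := (OpenPartialHomeomorph.univUnitBall : OpenPartialHomeomorph (𝔼 4) (𝔼 4)) with hφ
  have hφc : Continuous φ := (OpenPartialHomeomorph.contDiff_univUnitBall (n := 1)).continuous
  have hsrc : ∀ x : 𝔼 4, x ∈ φ.source := fun x ↦ by
    simp [hφ, OpenPartialHomeomorph.univUnitBall_source]
  have htgt : φ.target = ball (0 : 𝔼 4) 1 := by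
    simp [hφ, OpenPartialHomeomorph.univUnitBall_target]
  set S : Set (𝔼 4) := φ ⁻¹' (g '' closedBall (0 : 𝔼 2) 1) with hS
  have hScl : IsClosed S :=
    ((isCompact_closedBall (0 : 𝔼 2) 1).image hg.1.continuous).isClosed.preimage hφc
  -- a point of the closed disc sent into the open ball lies in the open disc
  have hdisc : ∀ y ∈ closedBall (0 : 𝔼 2) 1, ‖g y‖ < 1 → ‖y‖ < 1 := by
    intro y hy hgy
    rcases (mem_closedBall_zero_iff.1 hy).lt_or_eq with h | h
    · exact h
    · exfalso
      have h1 : ‖g y‖ = 1 := by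
        have e := hg.2.2.2.2.2 ⟨y, mem_sphere_zero_iff_norm.2 h⟩
        simp only at e
        rw [e]
        exact norm_eq_of_mem_sphere _
      exact hgy.ne h1
  have hSsub : S ⊆ ⋃ _ : Unit, (φ.symm ∘ g) '' ball (0 : 𝔼 2) 1 := by
    rintro x ⟨y, hy, hxy⟩
    have hφx : φ x ∈ ball (0 : 𝔼 4) 1 := htgt ▸ φ.map_source (hsrc x)
    have hy1 : ‖y‖ < 1 := hdisc y hy (by rw [hxy]; exact mem_ball_zero_iff.1 hφx)
    refine mem_iUnion.2 ⟨(), y, mem_ball_zero_iff.2 hy1, ?_⟩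
    show φ.symm (g y) = x
    rw [hxy]
    exact φ.left_inv (hsrc x)
  have hmaps : MapsTo g (ball (0 : 𝔼 2) 1) (ball (0 : 𝔼 4) 1) := fun y hy ↦
    mem_ball_zero_iff.2 (hg.2.2.2.1 y (mem_ball_zero_iff.1 hy))
  have hsmooth : ∀ _ : Unit,
      ContMDiffOn 𝓘(ℝ, 𝔼 2) 𝓘(ℝ, 𝔼 4) 1 (φ.symm ∘ g) (ball (0 : 𝔼 2) 1) := by
    intro
    rw [contMDiffOn_iff_contDiffOn]
    have h1 : ContDiffOn ℝ 1 φ.symm (ball (0 : 𝔼 4) 1) :=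
      OpenPartialHomeomorph.contDiffOn_univUnitBall_symm
    have h2 : ContDiffOn ℝ 1 g (ball (0 : 𝔼 2) 1) :=
      (hg.1.of_le (by exact_mod_cast le_top)).contDiffOn
    exact h1.comp h2 hmaps
  have hSint : ∀ x ∈ S, (𝓘(ℝ, 𝔼 4)).IsInteriorPoint x := fun x _ ↦
    BoundarylessManifold.isInteriorPoint
  have hdim : Module.finrank ℝ (𝔼 2) + 2 ≤ Module.finrank ℝ (𝔼 4) := by
    simp only [finrank_euclideanSpace_fin]
    norm_num
  have hpc : IsPathConnected Sᶜ :=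
    isPathConnected_compl_of_subset_iUnion_image (I := 𝓘(ℝ, 𝔼 4)) hdim hScl hSint
      (fun _ : Unit ↦ φ.symm ∘ g) (fun _ ↦ ball (0 : 𝔼 2) 1) (fun _ ↦ isOpen_ball) hsmooth hSsub
  -- the exterior is the image of `Sᶜ` under `φ`
  have himage : (sliceDiscExterior g : Set (𝔼 4)) = φ '' Sᶜ := by
    rw [coe_sliceDiscExterior_of_continuous hg.1.continuous]
    ext x
    constructor
    · rintro ⟨hx, hxg⟩
      have hxt : x ∈ φ.target := htgt ▸ hx
      refine ⟨φ.symm x, fun h ↦ hxg ?_, φ.right_inv hxt⟩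
      have h' : φ (φ.symm x) ∈ g '' closedBall (0 : 𝔼 2) 1 := h
      rwa [φ.right_inv hxt] at h'
    · rintro ⟨z, hz, rfl⟩
      exact ⟨htgt ▸ φ.map_source (hsrc z), hz⟩
  rw [himage]
  exact hpc.image hφc

/-- The open slice-disc exterior of a slice disc is a path-connected space. [folklore] -/
theorem pathConnectedSpace_sliceDiscExterior {K : Knot} {g : 𝔼 2 → 𝔼 4} (hg : K.IsSliceDisc g) :
    PathConnectedSpace (sliceDiscExterior g) :=
  isPathConnected_iff_pathConnectedSpace.1 (isPathConnected_sliceDiscExterior hg)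

/-! ### Surgered `3`-manifolds are path connected -/

/-- A `3`-manifold obtained by integral surgery on a knot is path connected (it is connected,
`IsIntegralSurgery.connectedSpace_holds`, and locally path connected as a manifold). [folklore] -/
theorem pathConnectedSpace_of_isIntegralSurgery {Y : Type*} [TopologicalSpace Y]
    [ChartedSpace (𝔼 3) Y] {K : Knot} {m : ℤ} (h : IsIntegralSurgery (𝓡 3) Y K m) :
    PathConnectedSpace Y := by
  haveI : ConnectedSpace Y := IsIntegralSurgery.connectedSpace_holds h
  haveI : LocallyPathConnectedSpace Y := ChartedSpace.locallyPathConnectedSpace (𝔼 3) Y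
  exact pathConnectedSpace_iff_connectedSpace.2 inferInstance

/-! ### Fundamental group bookkeeping -/

section Bridge

variable {X Z : Type*} [TopologicalSpace X] [TopologicalSpace Z]

/-- The induced map on fundamental groups kills the class of a loop exactly when the image loop
is null-homotopic. [folklore] -/
theorem FundamentalGroup.map_fromPath_eq_one_iff (f : C(X, Z)) {x : X} (γ : Path x x) :
    FundamentalGroup.map f x (FundamentalGroup.fromPath (Path.Homotopic.Quotient.mk γ)) = 1 ↔
      (γ.map f.continuous).Homotopic (Path.refl (f x)) := by
  rw [FundamentalGroup.one_def]
  change Path.Homotopic.Quotient.map (Path.Homotopic.Quotient.mk γ) f =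
    Path.Homotopic.Quotient.mk (Path.refl (f x)) ↔ _
  rw [← Path.Homotopic.Quotient.mk_map]
  exact Quotient.eq

end Bridge

section ExteriorLoops

variable {E_A H_A : Type*} [NormedAddCommGroup E_A] [NormedSpace ℝ E_A] [TopologicalSpace H_A]
  {I_A : ModelWithCorners ℝ E_A H_A} {A : Type*} [TopologicalSpace A] [ChartedSpace H_A A]
  {E_P : Type*} [NormedAddCommGroup E_P] [NormedSpace ℝ E_P]
  {K : Knot} {g : 𝔼 2 → 𝔼 4}

/-- **`π₁(V)` is normally generated by `π₁(∂V)`, in the form used for the gluing.** Let the open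
slice-disc exterior `E = B̊⁴ ∖ Δ` of a slice disc be glued (`SmoothGlueData`) to a simply connected
manifold `A` along an open region `R ⊆ E` (the target of the gluing map) which is path connected
and has compact complement in `E` — a collar of the end of `E`. Then every loop of `E` based at a
point of `R` becomes null-homotopic in the glued space. Proof: Seifert–van Kampen in kernel form
(`VanKampen.fromPath_mem_of_homotopic_refl`, Hatcher Thm. 1.20) for the cover
`ℝ⁴ ⊇ B̊⁴ = E ∪ (ℝ⁴ ∖ (E ∖ R))` of the simply connected `ℝ⁴`, with `N` the kernel of
`inr_* : π₁(E) → π₁(A ∪ E)`: a loop of `E` inside `ℝ⁴ ∖ (E ∖ R)` lies in `R`, so its image lies in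
`inl(A)`, which is simply connected; hence `N` contains all such classes, and van Kampen puts every
class of `π₁(E)` (all loops being null-homotopic in `ℝ⁴`) in `N`. This is Manolescu–Piccirillo's
"it is routine to confirm … that `π₁(V)` is normally generated by `ι_*(π₁(∂V))`" combined with the
vanishing of those generators in `X`. [cite: ManolescuPiccirillo2023, §3.2, proof of Lemma 3.3] -/
theorem map_inr_homotopic_refl_of_mem_target [SimplyConnectedSpace A] (hg : K.IsSliceDisc g)
    (d : SmoothGlueData I_A (𝓡 4) A (sliceDiscExterior g) E_P) (hcore : IsCompact d.glue.targetᶜ)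
    (htgt : IsPathConnected d.glue.target) {b₀ : sliceDiscExterior g} (hb₀ : b₀ ∈ d.glue.target)
    (γ : Path b₀ b₀) : (γ.map d.continuous_inr).Homotopic (Path.refl (d.inr b₀)) := by
  obtain ⟨x₀, hx₀⟩ := b₀
  -- the van Kampen data in the ambient `ℝ⁴`
  set U : Set (𝔼 4) := (sliceDiscExterior g : Set (𝔼 4)) with hU
  set L : Set (𝔼 4) := Subtype.val '' d.glue.targetᶜ with hL
  have hLc : IsCompact L := hcore.image continuous_subtype_val
  have hLU : L ⊆ U := by
    rintro _ ⟨z, -, rfl⟩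
    exact z.2
  have hUo : IsOpen U := (sliceDiscExterior g).isOpen
  have hTo : IsOpen Lᶜ := hLc.isClosed.isOpen_compl
  have hUT : U ∪ Lᶜ = univ := by
    refine eq_univ_of_forall fun z ↦ ?_
    by_cases hz : z ∈ L
    · exact Or.inl (hLU hz)
    · exact Or.inr hz
  have hmeetEq : U ∩ Lᶜ = Subtype.val '' d.glue.target := by
    ext z
    constructor
    · rintro ⟨hzU, hzL⟩
      refine ⟨⟨z, hzU⟩, ?_, rfl⟩
      by_contra h
      exact hzL ⟨⟨z, hzU⟩, h, rfl⟩
    · rintro ⟨w, hw, rfl⟩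
      refine ⟨w.2, ?_⟩
      rintro ⟨w', hw', he⟩
      rw [Subtype.val_injective he] at hw'
      exact hw' hw
  have hmeet : IsPathConnected (U ∩ Lᶜ) := by
    rw [hmeetEq]
    exact htgt.image continuous_subtype_val
  have hUpc : IsPathConnected U := isPathConnected_sliceDiscExterior hg
  have hxT : x₀ ∈ Lᶜ := by
    rintro ⟨w, hw, he⟩
    have : w = ⟨x₀, hx₀⟩ := Subtype.ext he
    rw [this] at hw
    exact hw hb₀
  -- the normal subgroup: the kernel of `inr_*`
  let F : C(sliceDiscExterior g, d.Glued) := ⟨d.inr, d.continuous_inr⟩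
  let N : Subgroup (FundamentalGroup (sliceDiscExterior g) ⟨x₀, hx₀⟩) :=
    (FundamentalGroup.map F ⟨x₀, hx₀⟩).ker
  have hN : ∀ δ : Path (⟨x₀, hx₀⟩ : sliceDiscExterior g) ⟨x₀, hx₀⟩, (∀ t, (δ t : 𝔼 4) ∈ Lᶜ) →
      FundamentalGroup.fromPath (Path.Homotopic.Quotient.mk δ) ∈ N := by
    intro δ hδ
    rw [MonoidHom.mem_ker, FundamentalGroup.map_fromPath_eq_one_iff]
    apply Path.Homotopic.refl_of_forall_mem_range_of_simplyConnected
      d.isOpenEmbedding_inl.isEmbedding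
    intro t
    show d.inr (δ t) ∈ range d.inl
    rw [d.inr_mem_range_inl_iff]
    by_contra h
    exact hδ t ⟨δ t, h, rfl⟩
  have hres := VanKampen.fromPath_mem_of_homotopic_refl hUo hTo hUT hUpc hmeet hx₀ hxT N hN γ
    (SimplyConnectedSpace.paths_homotopic _ _)
  rw [MonoidHom.mem_ker, FundamentalGroup.map_fromPath_eq_one_iff] at hres
  exact hres

/-- The same for loops of `E` at an arbitrary base point (conjugate by a path into the gluing
region, `E` being path connected): every loop of the exterior dies in the glued space.
[cite: ManolescuPiccirillo2023, §3.2, proof of Lemma 3.3] -/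
theorem map_inr_homotopic_refl [SimplyConnectedSpace A] (hg : K.IsSliceDisc g)
    (d : SmoothGlueData I_A (𝓡 4) A (sliceDiscExterior g) E_P) (hcore : IsCompact d.glue.targetᶜ)
    (htgt : IsPathConnected d.glue.target) (b : sliceDiscExterior g) (β : Path b b) :
    (β.map d.continuous_inr).Homotopic ((Path.refl b).map d.continuous_inr) := by
  obtain ⟨b₀, hb₀⟩ := htgt.nonempty
  haveI : PathConnectedSpace (sliceDiscExterior g) := pathConnectedSpace_sliceDiscExterior hg
  let p : Path b₀ b := PathConnectedSpace.somePath b₀ b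
  have h1 := map_inr_homotopic_refl_of_mem_target hg d hcore htgt hb₀ ((p.trans β).trans p.symm)
  rw [Path.map_trans, Path.map_trans, ← Path.map_symm] at h1
  have h2 := Path.Homotopic.refl_of_conj (p.map d.continuous_inr) h1
  have e : (Path.refl b).map d.continuous_inr = Path.refl (d.inr b) := by
    ext
    rfl
  rw [e]
  exact h2

/-- **A simply connected manifold glued to a slice-disc exterior along a collar of its end is
simply connected** — the abstract form of Manolescu–Piccirillo's computation
`π₁(X(−K') ∪_φ V) = π₁(V)/⟨⟨φ(μ_{K'})⟩⟩ = 1`: the trace side is simply connected, the gluing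
region (`≅ ∂V × ℝ`) is path connected, and `π₁(V)` is normally generated by the image of
`π₁(∂V)`, all of which dies on the trace side.
[cite: ManolescuPiccirillo2023, §3.2, proof of Lemma 3.3] -/
theorem simplyConnectedSpace_glued_sliceDiscExterior [SimplyConnectedSpace A]
    (hg : K.IsSliceDisc g) (d : SmoothGlueData I_A (𝓡 4) A (sliceDiscExterior g) E_P)
    (hcore : IsCompact d.glue.targetᶜ) (htgt : IsPathConnected d.glue.target) :
    SimplyConnectedSpace d.Glued :=
  haveI : PathConnectedSpace (sliceDiscExterior g) := pathConnectedSpace_sliceDiscExterior hg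
  d.simplyConnectedSpace_glued htgt
    (fun a α ↦ (SimplyConnectedSpace.paths_homotopic α (Path.refl a)).map ⟨d.inl, d.continuous_inl⟩)
    (map_inr_homotopic_refl hg d hcore htgt)

end ExteriorLoops


/-! ### Manolescu–Piccirillo's `X = X(K') ∪_Y V` is simply connected; the DAG without `PI1` -/

/-- Local notation: `𝔻²` is the closed unit disc in `ℝ²`. -/
local notation "𝔻²" => Metric.closedBall (0 : EuclideanSpace ℝ (Fin 2)) 1

section OfCollars

variable {Y : Type*} [TopologicalSpace Y] [ChartedSpace (𝔼 3) Y]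
  {T : Type*} [TopologicalSpace T] [ChartedSpace (𝔼 4) T]
  {E_P : Type*} [NormedAddCommGroup E_P] [NormedSpace ℝ E_P]
  {K : Knot} {g : 𝔼 2 → 𝔼 4}
  {cT : OpenPartialHomeomorph (Y × ℝ) T} {cV : OpenPartialHomeomorph (Y × ℝ) (sliceDiscExterior g)}
  {hsT : cT.source = univ} {hsV : cV.source = univ}
  {hcT : ContMDiffOn ((𝓡 3).prod 𝓘(ℝ, ℝ)) (𝓡 4) ∞ cT cT.source}
  {hcT' : ContMDiffOn (𝓡 4) ((𝓡 3).prod 𝓘(ℝ, ℝ)) ∞ cT.symm cT.target}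
  {hcV : ContMDiffOn ((𝓡 3).prod 𝓘(ℝ, ℝ)) (𝓡 4) ∞ cV cV.source}
  {hcV' : ContMDiffOn (𝓡 4) ((𝓡 3).prod 𝓘(ℝ, ℝ)) ∞ cV.symm cV.target}
  {linA : (𝔼 4) ≃L[ℝ] E_P} {linB : (𝔼 4) ≃L[ℝ] E_P}

/-- **`π₁(X(K') ∪_Y V) = 1`** (Manolescu–Piccirillo, proof of Lemma 3.3: "we see that `X` has a
handle diagram obtained from that of `V` by adding an additional 0-framed 2-handle along
`φ(μ_{K'})`, followed by a 4-handle. As such, `π₁(X) = π₁(V)/⟨[φ(μ_{K'})]⟩`. Since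
`π₁(S³₀(K'))/⟨[μ_{K'}]⟩ = 1` we have `π₁(∂V)/⟨[φ(μ_{K'})]⟩ = 1`. Since `π₁(V)` is normally generated by
`π₁(∂V)`, we have that `π₁(X) = 1`"), for the tree's presentation of `X` as the gluing
`SmoothGlueData.ofCollars cT cV …` of a simply connected manifold `T` (the open trace of `K'`,
`TubeNbhd.simplyConnectedSpace_openTrace`, `OpenTraceSimplyConnected.lean`) and the open slice-disc
exterior `B̊⁴ ∖ Δ` of `K` along
collars `cT`, `cV` of a path-connected `Y` (the common `0`-surgery), the core `(B̊⁴ ∖ Δ) ∖ cV(Y × ℝ)`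
being compact. In this presentation the two quoted facts about `∂V` merge into one application of
van Kampen's theorem in `B̊⁴` (`simplyConnectedSpace_glued_sliceDiscExterior`).
[cite: ManolescuPiccirillo2023, §3.2, proof of Lemma 3.3] -/
theorem simplyConnectedSpace_ofCollars_sliceDiscExterior [SimplyConnectedSpace T]
    [PathConnectedSpace Y] (hg : K.IsSliceDisc g) (hKV : IsCompact cV.targetᶜ) :
    SimplyConnectedSpace
      (SmoothGlueData.ofCollars cT cV hsT hsV hcT hcT' hcV hcV' linA linB).Glued := by
  refine simplyConnectedSpace_glued_sliceDiscExterior hg _ ?_ ?_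
  · rwa [SmoothGlueData.ofCollars_glue_target]
  · rw [SmoothGlueData.ofCollars_glue_target, ← cV.image_source_eq_target, hsV]
    refine isPathConnected_univ.image' ?_
    simpa [hsV] using cV.continuousOn

end OfCollars

namespace Knot

/-- **The open trace, with its simple connectivity recorded**: the proved leaf (T)
`Knot.exists_openTrace_of_isIntegralSurgery_holds` (`OpenTraceCollar.lean`) produces the open trace
`TubeNbhd.OpenTrace` of a shrunk tube, which is simply connected
(`TubeNbhd.simplyConnectedSpace_openTrace`, `OpenTraceSimplyConnected.lean`); this restates that
leaf with the extra clause.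
[cite: ManolescuPiccirillo2023, §3.2 Def. 3.4] -/
theorem exists_simplyConnected_openTrace_of_isIntegralSurgery (K : Knot) (m : ℤ) (Y : Type)
    [TopologicalSpace Y] [ChartedSpace (𝔼 3) Y] (hY : IsIntegralSurgery (𝓡 3) Y K m) :
    ∃ (T : Type) (_ : TopologicalSpace T) (_ : T2Space T) (_ : ChartedSpace (𝔼 4) T)
      (_ : IsManifold (𝓡 4) ∞ T) (_ : SimplyConnectedSpace T) (e : 𝔼 4 → T) (f : 𝔼 2 → T)
      (c : OpenPartialHomeomorph (Y × ℝ) T),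
      K.IsSliceDiscIn T e f ∧ c.source = univ ∧
        ContMDiffOn ((𝓡 3).prod 𝓘(ℝ, ℝ)) (𝓡 4) ∞ c c.source ∧
        ContMDiffOn (𝓡 4) ((𝓡 3).prod 𝓘(ℝ, ℝ)) ∞ c.symm c.target ∧
        c.target = (e '' Metric.closedBall (0 : 𝔼 4) 1 ∪ f '' 𝔻²)ᶜ ∧
        (∀ a : ℝ, IsCompact ((e '' Metric.closedBall (0 : 𝔼 4) 1 ∪ f '' 𝔻²) ∪
          c '' {p | p.2 ≤ a})) ∧
        ∀ a : ℝ, IsClosed (c '' {p | a ≤ p.2}) := by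
  obtain ⟨νK, -, jA, jB, hG⟩ := hY
  have hG' : νK.toTubeNbhd.IsSurgeryWith jA jB := hG
  exact ⟨νK.toTubeNbhd.shrink.OpenTrace, inferInstance, inferInstance, inferInstance, inferInstance,
    νK.toTubeNbhd.shrink.simplyConnectedSpace_openTrace,
    νK.toTubeNbhd.shrink.traceGlueData.inl, νK.toTubeNbhd.shrink.coreDisc,
    νK.toTubeNbhd.collarPH hG',
    TubeNbhd.isSliceDiscIn K νK.toTubeNbhd.shrink, rfl,
    (νK.toTubeNbhd.contMDiff_collar hG').contMDiffOn, νK.toTubeNbhd.contMDiffOn_collarInv hG', rfl,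
    νK.toTubeNbhd.isCompact_coreC_union_image_le hG', νK.toTubeNbhd.isClosed_image_collar_ge hG'⟩

/-- **Manolescu–Piccirillo, proof of Lemma 3.3 for `W = S⁴`, everything but Whitehead — from the
end collar of the exterior and the homology leaf only.** Glue the (simply connected) open trace of
`K'` to the open exterior `B̊⁴ ∖ Δ` of a slice disc of `K` along their collars of the common
`0`-surgery `Y` (`SmoothGlueData.ofCollars`, as in
`ManolescuPiccirillo2023_lemma33_sphere_construction_of_collars`); the glued closed `4`-manifold `X`
carries the proper disc for `K'`, is simply connected by
`simplyConnectedSpace_ofCollars_sliceDiscExterior` (proved here), and has `H₂(X; ℤ) = 0` by the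
homology leaf `isZero_singularHomologyZ_two_of_isSliceDiscIn_of_range_eq`. Compared with
`ManolescuPiccirillo2023_lemma33_sphere_core_of_facts` the fundamental-group leaf
`simplyConnectedSpace_of_isSliceDiscIn_of_range_eq` is no longer an input.
[cite: ManolescuPiccirillo2023, §3.2, proof of Lemma 3.3] -/
theorem ManolescuPiccirillo2023_lemma33_sphere_core_of_endCollar
    (hV : IsSliceDisc.exists_endCollar_of_isIntegralSurgery_zero)
    (hH : isZero_singularHomologyZ_two_of_isSliceDiscIn_of_range_eq.{0}) :
    ManolescuPiccirillo2023_lemma33_sphere_core := by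
  intro K K' Y _ _ hK hK' hslice
  obtain ⟨g, hg⟩ := hslice
  obtain ⟨T, _, _, _, _, _, e, f, cT, hef, hsT, hcT, hcT', htT, hKT, hclT⟩ :=
    exists_simplyConnected_openTrace_of_isIntegralSurgery K' 0 Y hK'.isIntegralSurgery
  obtain ⟨cV, hsV, hcV, hcV', hclV, hKV⟩ := hV K Y hK.isIntegralSurgery g hg
  haveI : PathConnectedSpace Y := pathConnectedSpace_of_isIntegralSurgery hK.isIntegralSurgery
  -- the compact core `C = e(𝔻⁴) ∪ f(𝔻²)` of the trace side
  set C : Set T := e '' Metric.closedBall (0 : 𝔼 4) 1 ∪ f '' 𝔻² with hC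
  have hCt : cT.targetᶜ = C := by rw [htT, compl_compl]
  -- the gluing datum and the glued manifold
  let d : SmoothGlueData (𝓡 4) (𝓡 4) T (sliceDiscExterior g) (𝔼 4) :=
    SmoothGlueData.ofCollars cT cV hsT hsV hcT hcT' hcV hcV' (ContinuousLinearEquiv.refl ℝ _)
      (ContinuousLinearEquiv.refl ℝ _)
  haveI : T2Space d.Glued :=
    SmoothGlueData.t2Space_ofCollars (s := fun p : Y × ℝ ↦ p.2) continuous_snd hclT hclV
  haveI : CompactSpace d.Glued := by
    refine SmoothGlueData.compactSpace_ofCollars (fun p : Y × ℝ ↦ p.2) ?_ (hKV 0)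
    rw [hCt]
    exact hKT 0
  haveI : SecondCountableTopology d.Glued := d.secondCountableTopology
  have hcore : IsCompact cV.targetᶜ :=
    (hKV 0).of_isClosed_subset cV.open_target.isClosed_compl subset_union_left
  have hπ : SimplyConnectedSpace d.Glued :=
    simplyConnectedSpace_ofCollars_sliceDiscExterior hg hcore
  -- the differential of `inl` is injective (it is an immersion)
  have himm : ∀ x, Injective (mfderiv (𝓡 4) (𝓡 4) d.inl x) := by
    obtain ⟨F, _, _, hF⟩ := d.isSmoothEmbedding_inl.isImmersion
    exact fun x ↦ Manifold.IsImmersionAtOfComplement.mfderiv_injective (hF x) (by simp)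
  have hef' : K'.IsSliceDiscIn d.Glued (d.inl ∘ e) (d.inl ∘ f) :=
    hef.comp_of_injective d.inl_injective d.contMDiff_inl himm
      (d.isSmoothEmbedding_inl_comp hef.isSmoothEmbedding)
  have hrange :
      range d.inr = ((d.inl ∘ e) '' Metric.closedBall (0 : 𝔼 4) 1 ∪ (d.inl ∘ f) '' 𝔻²)ᶜ := by
    rw [SmoothGlueData.range_inr_ofCollars, hCt, hC, image_union, image_comp, image_comp]
  exact ⟨d.Glued, inferInstance, inferInstance, inferInstance, inferInstance, inferInstance,
    inferInstance, hπ, hH K K' g hg d.Glued _ _ d.inr hef' d.isSmoothEmbedding_inr hrange, _, _,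
    hef'⟩

/-- **Manolescu–Piccirillo, Lemma 3.3 for `W = S⁴`, from the end collar, the homology leaf and the
recognition of homotopy `4`-spheres** (Whitehead step
`ManolescuPiccirillo2023_lemma33_sphere_of_core`).
[cite: ManolescuPiccirillo2023, §3.2, Lemma 3.3] -/
theorem ManolescuPiccirillo2023_lemma33_sphere_of_endCollar
    (hV : IsSliceDisc.exists_endCollar_of_isIntegralSurgery_zero)
    (hH : isZero_singularHomologyZ_two_of_isSliceDiscIn_of_range_eq.{0})
    (hS10 : FourManifolds.nonempty_homotopyEquiv_sphere_four_iff.{0}) :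
    ManolescuPiccirillo2023_lemma33_sphere :=
  ManolescuPiccirillo2023_lemma33_sphere_of_core
    (ManolescuPiccirillo2023_lemma33_sphere_core_of_endCollar hV hH) hS10

/-- **Manolescu–Piccirillo, Lemma 3.3 for `W = S⁴`, from three named facts**: the framed conical tube
of a conical slice disc (`Knot.IsSliceDisc.exists_conicalTube_hasFraming_zero`; the conical
straightening `Knot.IsSliceDisc.exists_conical_diffeomorph_holds` is proved in
`SliceDiscEndCollarFactsProofs.lean`), the homology computation `H₂(X; ℤ) = 0` and the recognition of
homotopy `4`-spheres — the reduction `ManolescuPiccirillo2023_lemma33_sphere_of_sliceDisc_facts` with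
its inputs `h₁` and `hπ` discharged. [cite: ManolescuPiccirillo2023, §3.2, Lemma 3.3] -/
theorem ManolescuPiccirillo2023_lemma33_sphere_of_conicalTube
    (h₂ : IsSliceDisc.exists_conicalTube_hasFraming_zero)
    (hH : isZero_singularHomologyZ_two_of_isSliceDiscIn_of_range_eq.{0})
    (hS10 : FourManifolds.nonempty_homotopyEquiv_sphere_four_iff.{0}) :
    ManolescuPiccirillo2023_lemma33_sphere :=
  ManolescuPiccirillo2023_lemma33_sphere_of_endCollar
    (IsSliceDisc.exists_endCollar_of_isIntegralSurgery_zero_of_facts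
      IsSliceDisc.exists_conical_diffeomorph_holds h₂) hH hS10

/-- The exotic-sphere consequence under the same three facts plus the proved FGMW lemma: a pair of
knots with a common `0`-surgery, exactly one of which is smoothly slice, yields a knot slice in a
homotopy `4`-ball but not in `B⁴`. [cite: ManolescuPiccirillo2023, §1] -/
theorem exists_isHomotopyBallSlice_not_isSmoothlySlice_of_conicalTube
    (h₂ : IsSliceDisc.exists_conicalTube_hasFraming_zero)
    (hH : isZero_singularHomologyZ_two_of_isSliceDiscIn_of_range_eq.{0})
    (hS10 : FourManifolds.nonempty_homotopyEquiv_sphere_four_iff.{0})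
    (h : ∃ (K K' : Knot) (Y : Type) (_ : TopologicalSpace Y)
      (_ : ChartedSpace (𝔼 3) Y),
      (FramedLink.single K 0).IsSurgery (𝓡 3) Y ∧ (FramedLink.single K' 0).IsSurgery (𝓡 3) Y ∧
        K.IsSmoothlySlice ∧ ¬ K'.IsSmoothlySlice) :
    ∃ K : Knot, K.IsHomotopyBallSlice ∧ ¬ K.IsSmoothlySlice :=
  (ManolescuPiccirillo2023_lemma33_sphere_of_conicalTube h₂ hH
    hS10).exists_isHomotopyBallSlice_not_isSmoothlySlice h

end Knot

end Literature.Topology.FourManifolds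

end
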